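import Mathlib
import Literature.NumberTheory.Automorphic.ShimuraCurveRibetTakahashi
import Literature.NumberTheory.EllipticCurves.Isogeny
import Literature.NumberTheory.EllipticCurves.Szpiro
import Literature.NumberTheory.EllipticCurves.IsogenyIdProofs
import Literature.NumberTheory.EllipticCurves.SzpiroOfAbcProofs
import Literature.NumberTheory.DiophantineGeometry.PastenValuationProductsProofs
import Literature.NumberTheory.EllipticCurves.PastenHeightBounds
import Literature.NumberTheory.EllipticCurves.ModularDegreeFormulaProofs
import Literature.NumberTheory.EllipticCurves.ModularCurveManinConstantProofs
import Literature.NumberTheory.Sieve.DivisorBound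
import HarnessLib

/-!
# ShimuraCurveAnalytic

Topic `Literature/NumberTheory/Automorphic`. Named literature fact(s) relocated by the gate from `Summits/ABC/ABC/Theorems/RibetTakahashiSplitManyPrimeValuationProductJLPackagePrintedClass.lean`
(accept-time relocation of `[cite]`d propositions written inline in a Summits proposal; human ruling 2026-08-15).
Sources: Ransford1995, VignerasLNM800.

* `Literature.NumberTheory.Automorphic.shimuraCurve_pet_pos_ae_and_log_integrable`
-/

namespace Literature.NumberTheory.Automorphic

open MeasureTheory
open scoped MatrixGroups
open Literature.NumberTheory.Automorphic
open Literature.NumberTheory.EllipticCurves.ModularForms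
open CongruenceSubgroup

/-- **A.e. positivity and `log`-integrability of the Petersson density of a non-zero weight-two
form on a compact Shimura curve.** For `D > 1`, a Shimura curve datum `X` of level `(D, M)` and a
non-zero `h ∈ S₂(Γ₀^D(M))` (`CuspForm X.Gamma 2`): `|h(z)|² (Im z)² > 0` for almost every `z` in
the fundamental domain `X.fd`, and `log(|h(z)|² (Im z)²)` is integrable on `X.fd` (hyperbolic
measure). Standard: for `D > 1` the algebra `X.B` is ramified at the primes of `D`, hence a division
algebra, so `Γ₀^D(M) = ι(O¹)` is a discrete COCOMPACT subgroup of `SL₂(ℝ)` (Vignéras, Ch. IV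
Thm 1.1: `φ(O¹)` is discrete of finite covolume, cocompact when `H` is a field) and `Γ K = ℍ` for a
compact `K ⊆ ℍ`; the zeros of the holomorphic `h ≢ 0` on the connected `ℍ` are isolated (a null
set), `log |h|` is subharmonic and locally integrable (Ransford, Thm 2.2.2 and Thm 2.5.1
(Integrability Theorem)), `log Im z` is continuous, so `log(|h|² (Im z)²) ∈ L¹(K, dx dy/y²)`; and
`|h|² (Im z)²` is `Γ`-invariant in weight `2`, so its `log` is integrable on every measurable a.e.
fundamental domain as soon as it is on `K` (`∫_F |u| ≤ 2 ∫_K |u|` for `Γ`-invariant `u`, `Γ`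
countable, `μ` invariant). False for `D = 1` (at a cusp `log |f|² ∼ −4π Im z` is not
`dx dy/y²`-integrable), whence the hypothesis `1 < D`. [folklore]
[cite: VignerasLNM800, Ch. IV Thm. 1.1 (ι(O¹) discrete, finite covolume, cocompact for a division algebra)]
[cite: Ransford1995, Thm. 2.2.2 and Thm. 2.5.1 (log |f| subharmonic; locally integrable)]
[file NumberTheory/Automorphic/ShimuraCurveAnalytic] -/
def shimuraCurve_pet_pos_ae_and_log_integrable : Prop :=
  ∀ {D M : ℕ} (X : Literature.NumberTheory.Automorphic.ShimuraCurveData D M)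
    (h : CuspForm X.Gamma 2), 1 < D → h ≠ 0 →
    (∀ᵐ z ∂(MeasureTheory.volume.restrict X.fd), 0 < ‖h z‖ ^ 2 * z.im ^ 2) ∧
      MeasureTheory.IntegrableOn
        (fun z : UpperHalfPlane => Real.log (‖h z‖ ^ 2 * z.im ^ 2)) X.fd

end Literature.NumberTheory.Automorphic
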